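import Summits.BirchSwinnertonDyer.BirchSwinnertonDyer.Theorems.EisensteinDepletionAtTwoStarOddManinDoor
import Summits.BirchSwinnertonDyer.BirchSwinnertonDyer.Theorems.EisensteinDepletionAtTwoStarDoubleLiftFalse
import Summits.BirchSwinnertonDyer.BirchSwinnertonDyer.Theorems.EisensteinDepletionAtTwoStarEtaleLiftSecondPoint
import Summits.BirchSwinnertonDyer.BirchSwinnertonDyer.Theorems.EisensteinDepletionAtTwoStarEvenKummerForm
import Summits.BirchSwinnertonDyer.BirchSwinnertonDyer.Theorems.EisensteinDepletionAtTwoStarOptBNSFParityGroup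
import Summits.BirchSwinnertonDyer.BirchSwinnertonDyer.Theorems.EisensteinDepletionAtTwoStarOptBNSFCongruenceCore
import Literature.NumberTheory.EllipticCurves.TwoTorsionHalfPeriodProofs
import Literature.NumberTheory.EllipticCurves.ManinConstantGamma1ModularDegree
import HarnessLib

/-!
# Crux E1M `DepletedLambdaLawAtTwoMod` (stmt-BirchSwinnertonDyer-20341) FROM TWO PRINTS: (F) and UBD — line `star` v19, the parity split closed
# (lead star-p1 GEN 21, 2026-08-29)

END STATE OF LINE `star` at GEN 21.  GEN 20 (v16) had E1M ⇐ modularity + THREE prints {(F) cusp images reduce non-singularly, Abbes–Ullmo Thm A,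
UBD}.  GEN 21 REMOVES ABBES–ULLMO: its only use was «the Manin multiple `q` is odd at `2`» ((OddManin₂), door
`KummerDoor.depletedLambdaLawAtTwoMod_of_cusp_oddManin_ubd`), and (OddManin₂) is now a THEOREM of (F) + UBD by the PARITY SPLIT: if `q` were even, then for
every ÉTALE rational 2-torsion abscissa `x₀` of the optimal `W₀` the untwisted Kummer form on the parity cover is integral — the EVEN SQUARE LAW
`√(X−x₀T²)∘[2] ∈ ℤ⟦T⟧` (`EvenBranch.evenSquareLaw_int`, pure formal-group algebra) with `Z_q = [2]Z_{q/2}` — so UBD + Wohlfahrt force LIFT(x₀)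
(`evenLift_of_ubd`, via `EvenBranch.stub_evenKummerForm`); LIFT(x₀) + (F) produce a SECOND étale abscissa `x₁` (`SigmaNode.stub_etaleLiftSecondPoint`:
`α² − 32β = 1`), LIFT(x₁) likewise, and the two lifts contradict (F) at an odd bad prime (`EvenBranch.stub_doubleLiftFalse`).  Hence `q` is odd
(`oddManinAtTwo_of_cuspNonsingular_ubd`), and the v17 door gives E1M (`depletedLambdaLawAtTwoMod_of_cuspNonsingular_ubd`) and E1M_NSF
(`depletedLambdaLawAtTwoModNSF_of_cuspNonsingular_ubd`).

HONEST FRAMING: CONDITIONAL RESULTS — E1M (item 20341) and E1M_NSF (27021) are proved MODULO the two named facts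
`gamma1Parametrization_cuspImage_nonsingularReduction` [(F): Conrad–Edixhoven–Stein 2003 §6.1.2 + Katz–Mazur 12.6 + Silverman ATAEC IV.9.1] and
`CalegariDimitrovTang2025_unboundedDenominators` [UBD], plus E1M's own modularity binder; neither item is closed by this file; the leaf T-r3₂ and BSD are NOT
proved (PARTITION D-0054: none — r_an ≥ 2, axis S0; no S0 motion).  No `sorry`, no new definition.
-/

set_option linter.dupNamespace false
set_option autoImplicit false

noncomputable section

namespace Summit.BirchSwinnertonDyer.BirchSwinnertonDyer.Theorems.DepletionAtTwo.EvenBranch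

open scoped MatrixGroups ModularForm
open CongruenceSubgroup
open Literature.NumberTheory.EllipticCurves
open Literature.NumberTheory.EllipticCurves.Greenberg1999
open Literature.NumberTheory.EllipticCurves.ModularForms
open Summit.BirchSwinnertonDyer.BirchSwinnertonDyer.Theorems.DepletionAtTwo

/-- **LIFT from UBD (even multiple, étale point).**  For the optimal `(W₀, f, L₀ = q·Λ_f)` at odd level, ordinary at `2`, with `q` EVEN: every étale
rational 2-torsion abscissa `x₀` with half-period `λ/2` satisfies LIFT(x₀), `q{∞,γ∞}_f ∈ ℤλ + 2L₀` for all `γ ∈ Γ₁(N)` — otherwise the parity group is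
proper of finite index with parabolics, carries the integral anti-invariant cusp form of `EvenBranch.stub_evenKummerForm`, and the congruence core
(UBD + Wohlfahrt) gives `False`.  CONDITIONAL on UBD. [cite: CalegariDimitrovTang2025, Thm. 1.0.1] -/
theorem evenLift_of_ubd (hU : Literature.NumberTheory.Automorphic.CalegariDimitrovTang2025_unboundedDenominators) :
    ∀ (W₀ : WeierstrassCurve ℚ) [W₀.IsElliptic] [W₀.IsGloballyMinimal] ⦃N : ℕ⦄ [NeZero N]
      (f : CuspForm (CongruenceSubgroup.Gamma0 N) 2), IsNewformOf W₀ f → ¬ 2 ∣ N → IsOrdinaryAt W₀ 2 →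
      ∀ (L₀ : PeriodPair), IsNeronLatticeOf (W₀.baseChange ℂ) L₀ → ∀ (q : ℤ), q ≠ 0 → Even q →
      (∀ z ∈ periodLattice f, (q : ℂ) * z ∈ L₀.lattice) → (∀ z ∈ L₀.lattice, ∃ w ∈ periodLattice f, z = (q : ℂ) * w) →
      ∀ (x₀ : ℚ), HasRationalTwoTorsionX W₀ x₀ → ¬ TwoTorsionRamifiedAtTwo x₀ →
      ∀ (lam : ℂ), lam ∈ L₀.lattice → lam / 2 ∉ L₀.lattice →
        L₀.weierstrassP (lam / 2) - ((W₀.b₂ : ℚ) : ℂ) / 12 = ((x₀ : ℚ) : ℂ) →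
      (∀ (γ : SL(2, ℤ)) (hγ : γ ∈ CongruenceSubgroup.Gamma0 N), γ ∈ CongruenceSubgroup.Gamma1 N →
        ∃ k : ℤ, ∃ w ∈ L₀.lattice, ((q : ℚ) : ℂ) * cuspSymbol f ⟨γ, hγ⟩ = (k : ℂ) * lam + 2 * w) := by
  intro W₀ _ _ N _ f hW₀ h2N hord L₀ hL₀ q hq0 hev hin hout x₀ hx₀ hnr lam hlam hlam2 h℘ γ hγ hγ1
  have hin1 : ∀ z ∈ periodLatticeGamma1 f, ((q : ℚ) : ℂ) * z ∈ L₀.lattice := fun z hz ↦ by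
    rw [Rat.cast_intCast]
    exact hin z (periodLatticeGamma1_le_periodLattice f hz)
  obtain ⟨Γ', hΓ⟩ := ParityGroup.exists_parityGroup f L₀ (q : ℚ) hin1 hlam hlam2
  by_contra hnot
  have hne : ∃ γ₀ ∈ CongruenceSubgroup.Gamma1 N, γ₀ ∉ Γ' := by
    refine ⟨γ, hγ1, fun hmem ↦ hnot ?_⟩
    obtain ⟨hγ', -, hk⟩ := (hΓ γ).mp hmem
    exact hk
  haveI : Γ'.FiniteIndex := ParityGroup.finiteIndex_of_parity f L₀ (q : ℚ) hin1 hlam hlam2 hΓ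
  obtain ⟨k, h, M, hh, hanti, hM, hint⟩ :=
    EvenBranch.stub_evenKummerForm W₀ f hW₀ h2N hord L₀ hL₀ q hq0 hev hin hout x₀ hx₀ hnr lam hlam hlam2 h℘ Γ' hΓ hne
  exact CongruenceCore.false_of_antiinvariant_integral_cuspForm_wt hU (NeZero.ne N)
    (fun γ' hγ'1 htr ↦ ParityGroup.mem_of_trace_eq_two f L₀ (q : ℚ) lam hΓ hγ'1 htr) hne h hh hanti hM hint

/-- **(OddManin₂) FROM (F) + UBD — the parity split.**  For the `X₀(N)`-lattice-optimal curve `W₀` (Néron lattice `q·Λ_f`, `N` odd, ordinary at `2`)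
possessing an ÉTALE rational 2-torsion abscissa, the Manin multiple `q` is ODD: were it even, LIFT(x₀) (`evenLift_of_ubd`), a second étale abscissa
`x₁ ≠ x₀` (`SigmaNode.stub_etaleLiftSecondPoint`), LIFT(x₁), and `EvenBranch.stub_doubleLiftFalse` give `False` (with `N = N_{W₀}` by Carayol from
modularity and `N ≥ 11` since `S₂(Γ₀(N)) = 0` for `N ≤ 10`).  This is exactly the residue of Abbes–Ullmo's theorem that line `star` consumed; it is now
DERIVED.  CONDITIONAL on (F), UBD and modularity. [cite: CalegariDimitrovTang2025, Thm. 1.0.1] [cite: ConradEdixhovenStein2003, §6.1.2 proof of Lemma 6.1.6 (p. 381)] -/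
theorem oddManinAtTwo_of_cuspNonsingular_ubd (hnf : exists_isNewformOf) (hF : gamma1Parametrization_cuspImage_nonsingularReduction)
    (hU : Literature.NumberTheory.Automorphic.CalegariDimitrovTang2025_unboundedDenominators) :
    ∀ (W₀ : WeierstrassCurve ℚ) [W₀.IsElliptic] [W₀.IsGloballyMinimal] ⦃N : ℕ⦄ [NeZero N]
      (f : CuspForm (Gamma0 N) 2), IsNewformOf W₀ f → ¬ 2 ∣ N → IsOrdinaryAt W₀ 2 →
      ∀ (L₀ : PeriodPair), IsNeronLatticeOf (W₀.baseChange ℂ) L₀ → ∀ (q : ℤ), q ≠ 0 →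
      (∀ z ∈ periodLattice f, (q : ℂ) * z ∈ L₀.lattice) → (∀ z ∈ L₀.lattice, ∃ w ∈ periodLattice f, z = (q : ℂ) * w) →
      ∀ (x₀ : ℚ), HasRationalTwoTorsionX W₀ x₀ → ¬ TwoTorsionRamifiedAtTwo x₀ → Odd q := by
  intro W₀ _ _ N _ f hW₀ h2N hord L₀ hL₀ q hq0 hin hout x₀ hx₀ hnr
  by_contra hodd
  have hev : Even q := Int.not_odd_iff_even.mp hodd
  -- level = conductor (Carayol from modularity, tree) and `N ≥ 11`
  have h4lvl : KummerDoor.stub_levelEqConductor := KummerDoor.stub_levelEqConductor_of_modularity hnf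
  dsimp only [KummerDoor.stub_levelEqConductor] at h4lvl
  have hN₀ : W₀.conductorNorm ℤ = N := ((h4lvl N) hW₀).symm
  have h11 : 11 ≤ N := by
    by_contra hlt
    have hf0 : f = 0 := cuspForm_two_gamma0_eq_zero_of_le_ten (by omega) f
    have h1 : cuspCoeff f 1 = (W₀.LFunction 1 : ℂ) := hW₀.2 1
    rw [hf0, WeierstrassCurve.LFunction_apply_one] at h1
    have h0 : cuspCoeff (0 : CuspForm (CongruenceSubgroup.Gamma0 N) 2) 1 = 0 :=
      (cuspCoeffₗ (one_mem_strictPeriods_coe_gamma0 N) 1).map_zero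
    rw [h0] at h1
    norm_num at h1
  -- the half-period of `x₀`, LIFT(x₀), the second étale point, its half-period, LIFT(x₁), contradiction
  obtain ⟨lam, hlam, hlam2, h℘⟩ :=
    Literature.NumberTheory.EllipticCurves.exists_half_period_of_hasRationalTwoTorsionX W₀ L₀ hL₀ hx₀
  have hL : (∀ (γ : SL(2, ℤ)) (hγ : γ ∈ CongruenceSubgroup.Gamma0 N), γ ∈ CongruenceSubgroup.Gamma1 N →
        ∃ k : ℤ, ∃ w ∈ L₀.lattice, ((q : ℚ) : ℂ) * cuspSymbol f ⟨γ, hγ⟩ = (k : ℂ) * lam + 2 * w) :=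
    evenLift_of_ubd hU W₀ f hW₀ h2N hord L₀ hL₀ q hq0 hev hin hout x₀ hx₀ hnr lam hlam hlam2 h℘
  obtain ⟨x₁, hne, hx₁, hnr₁⟩ :=
    SigmaNode.stub_etaleLiftSecondPoint hF W₀ f hW₀ h2N hord L₀ hL₀ q hq0 hev hin hout x₀ hx₀ hnr lam hlam hlam2 h℘ hL
  obtain ⟨lam₁, hlam₁, hlam₁2, h℘₁⟩ :=
    Literature.NumberTheory.EllipticCurves.exists_half_period_of_hasRationalTwoTorsionX W₀ L₀ hL₀ hx₁
  have hL₁ : (∀ (γ : SL(2, ℤ)) (hγ : γ ∈ CongruenceSubgroup.Gamma0 N), γ ∈ CongruenceSubgroup.Gamma1 N →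
        ∃ k : ℤ, ∃ w ∈ L₀.lattice, ((q : ℚ) : ℂ) * cuspSymbol f ⟨γ, hγ⟩ = (k : ℂ) * lam₁ + 2 * w) :=
    evenLift_of_ubd hU W₀ f hW₀ h2N hord L₀ hL₀ q hq0 hev hin hout x₁ hx₁ hnr₁ lam₁ hlam₁ hlam₁2 h℘₁
  exact EvenBranch.stub_doubleLiftFalse hF W₀ f hW₀ h2N hN₀ h11 hord L₀ hL₀ q hq0 hev hin hout x₀ x₁ (Ne.symm hne) hx₀ hnr
    lam hlam hlam2 h℘ hx₁ hnr₁ lam₁ hlam₁ hlam₁2 h℘₁ hL hL₁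

/-- **E1M `DepletedLambdaLawAtTwoMod` (stmt-BirchSwinnertonDyer-20341) FROM THE TWO PRINTS (F) + UBD** (modularity being E1M's own first binder): the v17
door `KummerDoor.depletedLambdaLawAtTwoMod_of_cusp_oddManin_ubd` with (OddManin₂) DERIVED (`oddManinAtTwo_of_cuspNonsingular_ubd`).  Abbes–Ullmo is no
longer an input.  CONDITIONAL RESULT (two named facts); 20341 is NOT closed; BSD is not proved.
[cite: GreenbergVatsal2000, §3 Thm. (3.12), display (28)] [cite: ConradEdixhovenStein2003, §6.1.2 proof of Lemma 6.1.6 (p. 381)] [cite: CalegariDimitrovTang2025, Thm. 1.0.1] -/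
theorem depletedLambdaLawAtTwoMod_of_cuspNonsingular_ubd (hF : gamma1Parametrization_cuspImage_nonsingularReduction)
    (hU : Literature.NumberTheory.Automorphic.CalegariDimitrovTang2025_unboundedDenominators) :
    Summit.BirchSwinnertonDyer.BirchSwinnertonDyer.Theses.EisensteinDepletionAtTwo.DepletedLambdaLawAtTwoMod := by
  intro hmod
  have hnf : exists_isNewformOf := hmod
  exact KummerDoor.depletedLambdaLawAtTwoMod_of_cusp_oddManin_ubd hF (oddManinAtTwo_of_cuspNonsingular_ubd hnf hF hU) hU hmod

/-- **E1M_NSF `DepletedLambdaLawAtTwoModNSF` (stmt-BirchSwinnertonDyer-27021) FROM (F) + UBD + modularity** (restriction of the all-levels statement,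
`depletedLambdaLawAtTwoModNSF_of_depletedLambdaLawAtTwoMod`).  CONDITIONAL RESULT; 27021 is NOT closed.
[cite: GreenbergVatsal2000, §3 Thm. (3.12)] [cite: CalegariDimitrovTang2025, Thm. 1.0.1] -/
theorem depletedLambdaLawAtTwoModNSF_of_cuspNonsingular_ubd (hnf : exists_isNewformOf)
    (hF : gamma1Parametrization_cuspImage_nonsingularReduction)
    (hU : Literature.NumberTheory.Automorphic.CalegariDimitrovTang2025_unboundedDenominators) :
    Summit.BirchSwinnertonDyer.BirchSwinnertonDyer.Theses.EisensteinDepletionAtTwo.DepletedLambdaLawAtTwoModNSF :=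
  KummerDoor.depletedLambdaLawAtTwoModNSF_of_cusp_oddManin_ubd hF (oddManinAtTwo_of_cuspNonsingular_ubd hnf hF hU) hU

end Summit.BirchSwinnertonDyer.BirchSwinnertonDyer.Theorems.DepletionAtTwo.EvenBranch

end
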